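/-
Copyright (c) 2026 the pub-hodgecm-mathlib formalisation cell (harness21).  Prover seat hodgecm-mathlib-K2E3-p12 (g6): Track B «K2-LIT», ENGINE E1 (on loan
per chair word «β → E1»), h413 = stmt-HodgeConjecture-24833; campaign «EIS-WHITTAKER-2» of the dealer K2E1-plan (g4), rung W3 (deal 2026-09-04T07:19:01Z), FILE 4:
the CM head of ★ FILE 2 at an ADELIC frequency, the `hint` binder DISCHARGED for `Re z > 1`, and the Mellin currency of ★ W2-arch (dealer 07:28:09Z (i), 07:39:43Z).
-/
import Summits.HodgeConjecture.HodgeConjecture.Theorems.K2E1WhittakerCoefficientEulerProductU2        -- ★ p858382 FILE 2 (this seat): the CM head at a rational frequency, `coe_finFactor_cpow_eq_finprod`, …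
import Summits.HodgeConjecture.HodgeConjecture.Theorems.K2E1AdelicFourierCoeffEulerProductAdelic     -- ★ FILE 3 (this seat): the generic engine at an ADELIC frequency
import Summits.HodgeConjecture.HodgeConjecture.Theorems.K2E1IntertwiningScalarLineIntegralU2         -- ★ p858278 (K2E2-p12 g4, (3b)): `integrable_finFactor_rpow_neg_cm_two` (Godement at CM, `h_f^{−σ} ∈ L¹`, `σ > 1`)
import Summits.HodgeConjecture.HodgeConjecture.Theorems.K2E1ArchWhittakerContinuation                -- ★ p858148 W2-arch: `integral_onePlusSqPow_mul_phase_eq_mellin` (Gamma trick, Mellin currency)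
import HarnessLib

/-!
# K2·E1 — `K2E1WhittakerCoefficientEulerProductAdelicU2` («EIS-WHITTAKER-2», rung W3, FILE 4): THE WHITTAKER COEFFICIENT OF THE SPHERICAL FLAT SECTION OF `U(1,1)_{L∕L⁺}` AT AN
# ADELIC FREQUENCY `η ∈ 𝔸_{L⁺}` — `μ(D)⁻¹·∫ Φ₁(u)ψ(ηu) dμ = |d_{L⁺}|^{−1∕2}·(φ₀·∏_w 𝓦_w(η_w,z))·∏'_v W_v(η_v,z)`, UNCONDITIONALLY for `Re z > 1`, and `𝓦_w` in ★ W2-arch's MELLIN currency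

Track B ∕ K2-LIT, crux h413 = `stmt-HodgeConjecture-24833`, route of record `HCCMUnconditional`; cell `hodgecm-mathlib`, squad K2, ENGINE E1, campaign «EIS-WHITTAKER-2».  Dealer K2E1-plan (g4)
07:28:09Z asks (i) «the archimedean factor REWRITTEN through ★ `integral_onePlusSqPow_mul_phase_eq_mellin`» and 07:39:43Z «ADELIC frequency `η` (W3-cov ★ p858333 delivers `ξα⁻¹`); `hint` ⟸ ★ p858278
(3b) — discharge it if the bytes match».  THEOREMS ONLY (no `def`, no instance, no notation, no named-fact hypothesis, no `sorry`; default heartbeats); lane `--supports stmt-HodgeConjecture-24833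
--as helper` (count-neutral, closes no socket).  Separate file by the 400-line law (★ FILE 2 is 269 l.).  Conventions = memo of record `CONVENTIONS-W3W4-EisWhittaker2` §0 (R), §3.

THE MATHEMATICS [Garrett2018 §1.9–§1.10, §2.8–§2.9; Bump1997 §1.6, §3.7; MoeglinWaldspurger1995 II.1.7; TateThesis1967 §4.1].  W3-cov ★ `adeleFourierCoeff_bigCellLine_covariance`:
`𝓕Φ_{n(θx)t₀k}(ξ) = ‖d₀‖^{1−z}·ψ(−ξx)·∫ Φ₁(v)·ψ(ξα⁻¹·v) dμ(v)` with `Φ₁(v) = f_z(ι(w₀)·n(θv))` — the `g = 1` big-cell function at the ADELIC frequency `η = ξα⁻¹`.  This file evaluates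
`∫ Φ₁(v)·ψ(ηv) dμ(v)` for every `η ∈ 𝔸_{L⁺}` exactly as ★ FILE 2 did at `η = (ξ)_𝔸`:
* §1 **`flatSectionU_const_weylLongU_line_one_eq_cm_two`** — `Φ₁` IS the explicit tensor `t ↦ (φ₀·A(ι t_∞)^{−z})·h_f(t_f)^{−z}` (★ FILE 2 at `k = 1`; W3-cov's `Φ₁` VERBATIM);
  **`integrable_finFactor_cpow_neg_cm_two`** — THE BINDER `hint` OF ★ FILE 2 DISCHARGED for `Re z > 1`: `h_f^{−z} ∈ L¹(μ_f)` (★ p858278 `integrable_finFactor_rpow_neg_cm_two` at `σ = Re z`,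
  `‖h_f^{−z}‖ = h_f^{−Re z}`, measurability of `h_f = (h_f^{−σ})^{−1∕σ}`).
* §2 **`integral_archFactor_cpow_mul_adeleAddChar_eq_cm_two`** + HEAD **`inv_measure_mul_integral_line_mul_adeleAddChar_eq_cm_two`** (ALL `z`, ALL `η ∈ 𝔸_{L⁺}`):
  `μ(D)⁻¹·∫ Φ₁(t)·ψ(ηt) dμ(t) = (√|d_{L⁺}|)⁻¹·(φ₀·∏_{w∣∞ of L} ∫_ℝ (1 + (wδ)²x²)^{−z}·e^{−2πi·η_w·x} dx)·(μ_f(𝒪̂)⁻¹·∫ h_f(b)^{−z}·ψ_f(η_f b) dμ_f(b))`, `η_w = (ι η_∞)_{w|L⁺}` (★ FILE 3).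
* §3 **`hasProd_localWhittaker_adele_cm_two`** (binder `hint`) and **`…_of_one_lt_re`** (NO binder, `Re z > 1`): `HasProd (v ↦ W_v(η_v,z)) (μ_f(𝒪̂)⁻¹·∫ h_f^{−z}·ψ_f(η_f ·) dμ_f)`,
  `W_v(η_v,z) = ν_v(𝒪_v)⁻¹·∫ P_v(t)^{−z}·ψ_v(η_v t) dν_v(t)` (W2-fin ★ p858310's integrand off `S_δ`); exceptional finset `S_δ ∪ S(η_f)` NAMED (★ FILE 3).
* §4 **`inv_measure_mul_integral_line_mul_adeleAddChar_eq_prod_cm_two_of_one_lt_re`** — with the NAMED unramified values `hW : ∀ v ∉ S, W_v(η_v,z) = 1 − q_v^{−2z}` (W2-fin (d)), `Re z > 1`: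
  `μ(D)⁻¹·∫ Φ₁ψ(η·) dμ = (√|d_{L⁺}|)⁻¹·(φ₀·∏_w 𝓦_w)·((∏_{v∈S} W_v)·ζ^S_{L⁺}(2z)⁻¹)` — and **`…_mellin`**: the same with every `𝓦_w` in ★ W2-arch's Mellin currency
  `Γ(z)⁻¹·√(π∕c_w)·𝓜[e^{−t−A_w∕t}](z − ½)`, `c_w = (wδ)² > 0`, `A_w = π²η_w²∕c_w` (entire in `z` for `η_w ≠ 0` ★ §4, strip bound ★ `norm_mellin_expKernel_le`) — the form W4 ★ ∕ W5-A ★ ∕ W5-FINAL consume.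
HONEST LABEL: HC_CM is proved only modulo the 7 printed citations (2 remaining named inputs: hLiu418 = `stmt-HodgeConjecture-24832`, h413 = `stmt-HodgeConjecture-24833`) until rung 0
closes; this file asserts no named fact and closes no socket; count-neutral.  Remaining named input of §4: `hW` (W2-fin (d) ★ p858310, instantiated by the assembler at its conductor letters).

## References
* [Garrett2018] P. Garrett, *Modern Analysis of Automorphic Forms by Example* 1 (2018), §1.9–§1.10, §2.8–§2.9.
* [Bump1997] D. Bump, *Automorphic Forms and Representations* (1997), §1.6 (1.26)–(1.27), §3.7.
* [MoeglinWaldspurger1995] C. Mœglin, J.-L. Waldspurger, *Spectral Decomposition and Eisenstein Series* (1995), II.1.6–II.1.7.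
* [TateThesis1967] J. Tate, *Fourier analysis in number fields and Hecke's zeta-functions*, in Cassels–Fröhlich (1967), Ch. XV, §3.3, §4.1.
-/

set_option autoImplicit false
set_option linter.dupNamespace false -- the mandated namespace repeats `HodgeConjecture.HodgeConjecture`

noncomputable section

open MeasureTheory Measure NumberField NumberField.InfinitePlace NumberField.mixedEmbedding IsDedekindDomain IsDedekindDomain.HeightOneSpectrum Set Filter Topology
open scoped ENNReal NNReal Real FourierTransform Classical
open Literature.NumberTheory.Automorphic Literature.NumberTheory.Automorphic.UnitaryGroup AdelicGroupData
open Literature.NumberTheory.GaloisRepresentations.IsNonarchimedeanLocalField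
open Summit.HodgeConjecture.HodgeConjecture.Cruxes.H413
open Summit.HodgeConjecture.HodgeConjecture.Cruxes.H413.K2E1AdelicFourierCoeffEulerProduct
open Summit.HodgeConjecture.HodgeConjecture.Cruxes.H413.K2E1AdelicFourierCoeffEulerProductAdelic
open Summit.HodgeConjecture.HodgeConjecture.Cruxes.H413.K2E1WhittakerCoefficientEulerProductU2
open Summit.HodgeConjecture.HodgeConjecture.Cruxes.H413.K2E1HeightBigCellLineFormulaU2 (one_le_coe_finprod_line_cm_two sq_apply_pos_of_ne_zero)
open Summit.HodgeConjecture.HodgeConjecture.Cruxes.H413.K2E1IntertwiningScalarLineIntegralU2 (integrable_finFactor_rpow_neg_cm_two)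
open Summit.HodgeConjecture.HodgeConjecture.Cruxes.H413.K2E1ArchWhittakerContinuation (integral_onePlusSqPow_mul_phase_eq_mellin)
open Summit.HodgeConjecture.HodgeConjecture.Cruxes.H413.K2E1BorelEisensteinU (flatSectionU)

namespace Summit.HodgeConjecture.HodgeConjecture.Cruxes.H413.K2E1WhittakerCoefficientEulerProductAdelicU2

variable (L : Type) [Field L] [NumberField L] [IsCMField L]
  (hij : (((0 : Fin 2) : ℕ)) + 1 = ((1 : Fin 2) : ℕ)) (hN : 2 = 2 * ((0 : Fin 2) : ℕ) + 2)
  {δ : L} (hcδ : IsCMField.complexConj L δ = -δ) (hδ : δ ≠ 0)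

/-! ## §1 `Φ₁` is the explicit tensor; the binder `hint` discharged for `Re z > 1` -/

/-- **W3-cov's `Φ₁(t) = f_z(ι(w₀)·n(θt))` IS the explicit tensor** `(φ₀·A(ι t_∞)^{−z})·h_f(t_f)^{−z}` (★ FILE 2 `flatSectionU_const_weylLongU_line_eq_cm_two` at `k = 1`).
[cite: MoeglinWaldspurger1995, II.1.7] [cite: Garrett2018, §2.8] -/
theorem flatSectionU_const_weylLongU_line_one_eq_cm_two (φ₀ z : ℂ) (t : AdeleRing (𝓞 ↥(maximalRealSubfield L)) ↥(maximalRealSubfield L)) :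
    flatSectionU (fun _ => φ₀) z (((quasiSplit (↥(maximalRealSubfield L)) L (IsCMField.complexConj L) 2).toAdelic (weylLongU ((IsCMField.complexConj L : L ≃ₐ[↥(maximalRealSubfield L)] L) : L →+* L) (rfl : ((StdForm.antidiagonal 2).over L) = ((StdForm.antidiagonal 2).over L)))) * ((middleRootUnipotent hij hN (Multiplicative.ofAdd (traceZeroLine ↥(maximalRealSubfield L) L (IsCMField.complexConj L) hcδ hδ t)) : ↥(adelicUnipotent ↥(maximalRealSubfield L) L (IsCMField.complexConj L) 2)) : (quasiSplit (↥(maximalRealSubfield L)) L (IsCMField.complexConj L) 2).Adelic)) = (φ₀ * ((∏ w : InfinitePlace L, ((1 : ℝ) + (w δ) ^ 2 * ((InfiniteAdeleRing.ringEquiv_mixedSpace ↥(maximalRealSubfield L) t.1).1 ⟨w.comap (algebraMap ↥(maximalRealSubfield L) L), K2E1HeightBigCellLineFormulaU2.isReal_comap_maximalRealSubfield L w⟩) ^ 2) : ℝ) : ℂ) ^ (-z)) * (((∏ᶠ v : HeightOneSpectrum (𝓞 L), max 1 ‖((traceZeroLine ↥(maximalRealSubfield L) L (IsCMField.complexConj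 L) hcδ hδ ((0, t.2) : AdeleRing (𝓞 ↥(maximalRealSubfield L)) ↥(maximalRealSubfield L)) : traceZeroAdele ↥(maximalRealSubfield L) L (IsCMField.complexConj L)) : AdeleRing (𝓞 L) L).2 v‖₊ : ℝ≥0) : ℝ) : ℂ) ^ (-z) := by
  have h := flatSectionU_const_weylLongU_line_eq_cm_two L hij hN hcδ hδ (k := 1) (Subgroup.one_mem _) φ₀ z t
  rwa [mul_one] at h

include hij hN in
/-- **THE BINDER `hint` OF ★ FILE 2 DISCHARGED: `h_f^{−z} ∈ L¹(μ_f)` for `Re z > 1`** (★ p858278 `integrable_finFactor_rpow_neg_cm_two` at `σ = Re z` — Godement at CM through the line;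
`‖h_f(b)^{−z}‖ = h_f(b)^{−Re z}` as `h_f ≥ 1 > 0`; a.e.-measurability of `h_f = (h_f^{−σ})^{(−σ)⁻¹}`). [cite: MoeglinWaldspurger1995, II.1.6] [cite: TateThesis1967, §3.3] -/
theorem integrable_finFactor_cpow_neg_cm_two [MeasurableSpace (FiniteAdeleRing (𝓞 ↥(maximalRealSubfield L)) ↥(maximalRealSubfield L))] [BorelSpace (FiniteAdeleRing (𝓞 ↥(maximalRealSubfield L)) ↥(maximalRealSubfield L))]
    (μf : Measure (FiniteAdeleRing (𝓞 ↥(maximalRealSubfield L)) ↥(maximalRealSubfield L))) [μf.IsAddHaarMeasure] {z : ℂ} (hz : 1 < z.re) :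
    Integrable (fun b : FiniteAdeleRing (𝓞 ↥(maximalRealSubfield L)) ↥(maximalRealSubfield L) => (((∏ᶠ v : HeightOneSpectrum (𝓞 L), max 1 ‖((traceZeroLine ↥(maximalRealSubfield L) L (IsCMField.complexConj L) hcδ hδ ((0, b) : AdeleRing (𝓞 ↥(maximalRealSubfield L)) ↥(maximalRealSubfield L)) : traceZeroAdele ↥(maximalRealSubfield L) L (IsCMField.complexConj L)) : AdeleRing (𝓞 L) L).2 v‖₊ : ℝ≥0) : ℝ) : ℂ) ^ (-z)) μf := by
  letI : MeasurableSpace (quasiSplit (↥(maximalRealSubfield L)) L (IsCMField.complexConj L) 2).Adelic := borel _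
  haveI : BorelSpace (quasiSplit (↥(maximalRealSubfield L)) L (IsCMField.complexConj L) 2).Adelic := ⟨rfl⟩
  have hg := integrable_finFactor_rpow_neg_cm_two L hij hN hcδ hδ μf hz
  have hpos : ∀ b : FiniteAdeleRing (𝓞 ↥(maximalRealSubfield L)) ↥(maximalRealSubfield L),
      0 < ((∏ᶠ v : HeightOneSpectrum (𝓞 L), max 1 ‖((traceZeroLine ↥(maximalRealSubfield L) L (IsCMField.complexConj L) hcδ hδ ((0, b) : AdeleRing (𝓞 ↥(maximalRealSubfield L)) ↥(maximalRealSubfield L)) : traceZeroAdele ↥(maximalRealSubfield L) L (IsCMField.complexConj L)) : AdeleRing (𝓞 L) L).2 v‖₊ : ℝ≥0) : ℝ) :=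
    fun b => lt_of_lt_of_le one_pos (one_le_coe_finprod_line_cm_two L hcδ hδ b)
  have hz0 : (-z.re) ≠ 0 := by intro h; linarith
  -- a.e.-measurability of `h_f` from that of `h_f^{−σ}`
  have h1 : AEMeasurable (fun b : FiniteAdeleRing (𝓞 ↥(maximalRealSubfield L)) ↥(maximalRealSubfield L) =>
      ((∏ᶠ v : HeightOneSpectrum (𝓞 L), max 1 ‖((traceZeroLine ↥(maximalRealSubfield L) L (IsCMField.complexConj L) hcδ hδ ((0, b) : AdeleRing (𝓞 ↥(maximalRealSubfield L)) ↥(maximalRealSubfield L)) : traceZeroAdele ↥(maximalRealSubfield L) L (IsCMField.complexConj L)) : AdeleRing (𝓞 L) L).2 v‖₊ : ℝ≥0) : ℝ)) μf := by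
    refine ((hg.aestronglyMeasurable.aemeasurable.pow_const ((-z.re)⁻¹))).congr (Eventually.of_forall fun b => ?_)
    dsimp only
    rw [Real.rpow_rpow_inv (hpos b).le hz0]
  have hmeas : AEStronglyMeasurable (fun b : FiniteAdeleRing (𝓞 ↥(maximalRealSubfield L)) ↥(maximalRealSubfield L) => (((∏ᶠ v : HeightOneSpectrum (𝓞 L), max 1 ‖((traceZeroLine ↥(maximalRealSubfield L) L (IsCMField.complexConj L) hcδ hδ ((0, b) : AdeleRing (𝓞 ↥(maximalRealSubfield L)) ↥(maximalRealSubfield L)) : traceZeroAdele ↥(maximalRealSubfield L) L (IsCMField.complexConj L)) : AdeleRing (𝓞 L) L).2 v‖₊ : ℝ≥0) : ℝ) : ℂ) ^ (-z)) μf :=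
    ((Complex.measurable_ofReal.comp_aemeasurable h1).pow_const (-z)).aestronglyMeasurable
  refine hg.mono' hmeas (Eventually.of_forall fun b => ?_)
  rw [Complex.norm_cpow_eq_rpow_re_of_pos (hpos b), Complex.neg_re]

/-! ## §2 The head at an ADELIC frequency `η ∈ 𝔸_{L⁺}` -/

/-- **THE ARCHIMEDEAN FACTOR AT THE ARCHIMEDEAN FREQUENCY `η_∞`**: `∫ (φ₀·A(s)^{−z})·𝐞(−Tr(ιη_∞·s)) ds = φ₀·∏_{w∣∞ of L} ∫_ℝ (1 + (wδ)²x²)^{−z}·e^{−2πi·η_w·x} dx`, `η_w = (ιη_∞)_{w|L⁺}`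
(★ `ofReal_prod_cpow`, Mathlib `IsCMField.equivInfinitePlace`, ★ FILE 3 `integral_prod_mul_fourierChar_eq_prod_of_equiv'`). [cite: Bump1997, §1.6 (1.26)] [cite: Garrett2018, §1.10] -/
theorem integral_archFactor_cpow_mul_adeleAddChar_eq_cm_two (φ₀ z : ℂ) (η : AdeleRing (𝓞 ↥(maximalRealSubfield L)) ↥(maximalRealSubfield L)) :
    ∫ s : mixedSpace ↥(maximalRealSubfield L), (φ₀ * ((∏ w : InfinitePlace L, ((1 : ℝ) + (w δ) ^ 2 * (s.1 ⟨w.comap (algebraMap ↥(maximalRealSubfield L) L), K2E1HeightBigCellLineFormulaU2.isReal_comap_maximalRealSubfield L w⟩) ^ 2) : ℝ) : ℂ) ^ (-z)) *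
        (𝐞 (-(mixedTrace ↥(maximalRealSubfield L) (InfiniteAdeleRing.ringEquiv_mixedSpace ↥(maximalRealSubfield L) η.1 * s))) : ℂ) =
      (φ₀ * ∏ w : InfinitePlace L, ∫ x : ℝ, (((1 + (w δ) ^ 2 * x ^ 2 : ℝ)) : ℂ) ^ (-z) *
          Complex.exp (-(2 * π * Complex.I * (InfiniteAdeleRing.ringEquiv_mixedSpace ↥(maximalRealSubfield L) η.1).1 ⟨w.comap (algebraMap ↥(maximalRealSubfield L) L), K2E1HeightBigCellLineFormulaU2.isReal_comap_maximalRealSubfield L w⟩ * x))) := by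
  let e : InfinitePlace L ≃ {v : InfinitePlace ↥(maximalRealSubfield L) // v.IsReal} :=
    (IsCMField.equivInfinitePlace L).trans (Equiv.subtypeUnivEquiv fun v : InfinitePlace ↥(maximalRealSubfield L) => IsTotallyReal.isReal v).symm
  have he : ∀ w : InfinitePlace L, e w = ⟨w.comap (algebraMap ↥(maximalRealSubfield L) L), K2E1HeightBigCellLineFormulaU2.isReal_comap_maximalRealSubfield L w⟩ := fun w => rfl
  have key := integral_prod_mul_fourierChar_eq_prod_of_equiv' ↥(maximalRealSubfield L) e (fun w (x : ℝ) => (((1 + (w δ) ^ 2 * x ^ 2 : ℝ)) : ℂ) ^ (-z))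
    (InfiniteAdeleRing.ringEquiv_mixedSpace ↥(maximalRealSubfield L) η.1)
  simp only [he] at key
  have hsplit : ∀ s : mixedSpace ↥(maximalRealSubfield L), ((∏ w : InfinitePlace L, ((1 : ℝ) + (w δ) ^ 2 * (s.1 ⟨w.comap (algebraMap ↥(maximalRealSubfield L) L), K2E1HeightBigCellLineFormulaU2.isReal_comap_maximalRealSubfield L w⟩) ^ 2) : ℝ) : ℂ) ^ (-z) =
      ∏ w : InfinitePlace L, (((1 + (w δ) ^ 2 * (s.1 ⟨w.comap (algebraMap ↥(maximalRealSubfield L) L), K2E1HeightBigCellLineFormulaU2.isReal_comap_maximalRealSubfield L w⟩) ^ 2 : ℝ)) : ℂ) ^ (-z) :=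
    fun s => ofReal_prod_cpow Finset.univ _ (fun w _ => by positivity) (-z)
  have hpt : ∀ s : mixedSpace ↥(maximalRealSubfield L),
      (φ₀ * ((∏ w : InfinitePlace L, ((1 : ℝ) + (w δ) ^ 2 * (s.1 ⟨w.comap (algebraMap ↥(maximalRealSubfield L) L), K2E1HeightBigCellLineFormulaU2.isReal_comap_maximalRealSubfield L w⟩) ^ 2) : ℝ) : ℂ) ^ (-z)) * (𝐞 (-(mixedTrace ↥(maximalRealSubfield L) (InfiniteAdeleRing.ringEquiv_mixedSpace ↥(maximalRealSubfield L) η.1 * s))) : ℂ) =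
        φ₀ * ((∏ w : InfinitePlace L, (((1 + (w δ) ^ 2 * (s.1 ⟨w.comap (algebraMap ↥(maximalRealSubfield L) L), K2E1HeightBigCellLineFormulaU2.isReal_comap_maximalRealSubfield L w⟩) ^ 2 : ℝ)) : ℂ) ^ (-z)) *
          (𝐞 (-(mixedTrace ↥(maximalRealSubfield L) (InfiniteAdeleRing.ringEquiv_mixedSpace ↥(maximalRealSubfield L) η.1 * s))) : ℂ)) := fun s => by
    rw [hsplit s, mul_assoc]
  simp_rw [hpt]
  rw [integral_const_mul, key]

/-- **W3 HEAD AT AN ADELIC FREQUENCY.**  `L` CM, `U(1,1) = U(J₂)_{L∕L⁺}`, `δ ∈ L⁻ ∖ 0`, `μ := σ_*(volume ⊗ μ_f)` the split Haar measure of `𝔸_{L⁺}` (`μ_f` ANY `SFinite` measure on `𝔸_{L⁺,f}`),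
`Φ₁(t) = (φ₀·A(ι t_∞)^{−z})·h_f(t_f)^{−z}` (§1).  For EVERY `z : ℂ` and EVERY `η ∈ 𝔸_{L⁺}`:
`μ(D)⁻¹·∫ Φ₁(t)·ψ(ηt) dμ(t) = (√|d_{L⁺}|)⁻¹·(φ₀·∏_{w∣∞ of L} ∫_ℝ (1 + (wδ)²x²)^{−z}·e^{−2πi·η_w·x} dx)·(μ_f(𝒪̂)⁻¹·∫ h_f(b)^{−z}·ψ_f(η_f b) dμ_f(b))`
(★ FILE 3 splitting, ★ FILE 1 `μ(D) = √|d_{L⁺}|·μ_f(𝒪̂)`; no integrability needed — both sides carry the same Bochner junk).  At `η = (ξ)_𝔸` this is ★ FILE 2's head (`ιη_∞ = mixedEmbedding ξ`, ★ FILE 3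
`ringEquiv_mixedSpace_algebraMap_fst_and_snd`). [cite: Garrett2018, §1.9–§1.10] [cite: Bump1997, §3.7] [cite: TateThesis1967, §4.1] -/
theorem inv_measure_mul_integral_line_mul_adeleAddChar_eq_cm_two [MeasurableSpace (AdeleRing (𝓞 ↥(maximalRealSubfield L)) ↥(maximalRealSubfield L))] [BorelSpace (AdeleRing (𝓞 ↥(maximalRealSubfield L)) ↥(maximalRealSubfield L))]
    [MeasurableSpace (FiniteAdeleRing (𝓞 ↥(maximalRealSubfield L)) ↥(maximalRealSubfield L))] [BorelSpace (FiniteAdeleRing (𝓞 ↥(maximalRealSubfield L)) ↥(maximalRealSubfield L))] (μf : Measure (FiniteAdeleRing (𝓞 ↥(maximalRealSubfield L)) ↥(maximalRealSubfield L))) [SFinite μf]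
    {σ : mixedSpace ↥(maximalRealSubfield L) × FiniteAdeleRing (𝓞 ↥(maximalRealSubfield L)) ↥(maximalRealSubfield L) → AdeleRing (𝓞 ↥(maximalRealSubfield L)) ↥(maximalRealSubfield L)}
    (hσ : ∀ p, (σ p).1 = (InfiniteAdeleRing.ringEquiv_mixedSpace ↥(maximalRealSubfield L)).symm p.1 ∧ (σ p).2 = p.2) (φ₀ z : ℂ) (η : AdeleRing (𝓞 ↥(maximalRealSubfield L)) ↥(maximalRealSubfield L)) :
    ((((((volume : Measure (mixedSpace ↥(maximalRealSubfield L))).prod μf).map σ) (adeleFundamentalDomain ↥(maximalRealSubfield L))).toReal⁻¹ : ℝ) : ℂ) *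
        ∫ t, (φ₀ * ((∏ w : InfinitePlace L, ((1 : ℝ) + (w δ) ^ 2 * ((InfiniteAdeleRing.ringEquiv_mixedSpace ↥(maximalRealSubfield L) t.1).1 ⟨w.comap (algebraMap ↥(maximalRealSubfield L) L), K2E1HeightBigCellLineFormulaU2.isReal_comap_maximalRealSubfield L w⟩) ^ 2) : ℝ) : ℂ) ^ (-z)) * (((∏ᶠ v : HeightOneSpectrum (𝓞 L), max 1 ‖((traceZeroLine ↥(maximalRealSubfield L) L (IsCMField.complexConj L) hcδ hδ ((0, t.2) : AdeleRing (𝓞 ↥(maximalRealSubfield L)) ↥(maximalRealSubfield L)) : traceZeroAdele ↥(maximalRealSubfield L) L (IsCMField.complexConj L)) : AdeleRing (𝓞 L) L).2 v‖₊ : ℝ≥0) : ℝ) : ℂ) ^ (-z) * (adeleAddChar ↥(maximalRealSubfield L) (η * t) : ℂ) ∂(((volume : Measure (mixedSpace ↥(maximalRealSubfield L))).prod μf).map σ) =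
      (((NNReal.sqrt ‖discr ↥(maximalRealSubfield L)‖₊ : ℝ≥0) : ℝ)⁻¹ : ℂ) * (φ₀ * ∏ w : InfinitePlace L, ∫ x : ℝ, (((1 + (w δ) ^ 2 * x ^ 2 : ℝ)) : ℂ) ^ (-z) *
          Complex.exp (-(2 * π * Complex.I * (InfiniteAdeleRing.ringEquiv_mixedSpace ↥(maximalRealSubfield L) η.1).1 ⟨w.comap (algebraMap ↥(maximalRealSubfield L) L), K2E1HeightBigCellLineFormulaU2.isReal_comap_maximalRealSubfield L w⟩ * x))) *
        ((μf {b : FiniteAdeleRing (𝓞 ↥(maximalRealSubfield L)) ↥(maximalRealSubfield L) | ∀ v, b v ∈ v.adicCompletionIntegers ↥(maximalRealSubfield L)}).toReal⁻¹ •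
          ∫ b, (((∏ᶠ v : HeightOneSpectrum (𝓞 L), max 1 ‖((traceZeroLine ↥(maximalRealSubfield L) L (IsCMField.complexConj L) hcδ hδ ((0, b) : AdeleRing (𝓞 ↥(maximalRealSubfield L)) ↥(maximalRealSubfield L)) : traceZeroAdele ↥(maximalRealSubfield L) L (IsCMField.complexConj L)) : AdeleRing (𝓞 L) L).2 v‖₊ : ℝ≥0) : ℝ) : ℂ) ^ (-z) * (finiteAdeleAddChar ↥(maximalRealSubfield L) (η.2 * b) : ℂ) ∂μf) := by
  have key := integral_mul_adeleAddChar_map_split_eq_mul ↥(maximalRealSubfield L) (volume : Measure (mixedSpace ↥(maximalRealSubfield L))) μf hσ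
    (fun s => φ₀ * ((∏ w : InfinitePlace L, ((1 : ℝ) + (w δ) ^ 2 * (s.1 ⟨w.comap (algebraMap ↥(maximalRealSubfield L) L), K2E1HeightBigCellLineFormulaU2.isReal_comap_maximalRealSubfield L w⟩) ^ 2) : ℝ) : ℂ) ^ (-z)) (fun b => (((∏ᶠ v : HeightOneSpectrum (𝓞 L), max 1 ‖((traceZeroLine ↥(maximalRealSubfield L) L (IsCMField.complexConj L) hcδ hδ ((0, b) : AdeleRing (𝓞 ↥(maximalRealSubfield L)) ↥(maximalRealSubfield L)) : traceZeroAdele ↥(maximalRealSubfield L) L (IsCMField.complexConj L)) : AdeleRing (𝓞 L) L).2 v‖₊ : ℝ≥0) : ℝ) : ℂ) ^ (-z)) η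
  rw [key, measure_map_split_adeleFundamentalDomain ↥(maximalRealSubfield L) volume μf hσ, volume_fundamentalDomain_latticeBasis_of_isTotallyReal, ENNReal.toReal_mul,
    ENNReal.coe_toReal, integral_archFactor_cpow_mul_adeleAddChar_eq_cm_two L (δ := δ) φ₀ z η, mul_inv, Complex.ofReal_mul, Complex.ofReal_inv, Complex.ofReal_inv,
    Complex.real_smul, Complex.ofReal_inv]
  ring

/-! ## §3 The Euler product of the local Whittaker integrals at `η_f` — with `hint`, and unconditionally for `Re z > 1` -/

section Euler

variable [MeasurableSpace (FiniteAdeleRing (𝓞 ↥(maximalRealSubfield L)) ↥(maximalRealSubfield L))] [BorelSpace (FiniteAdeleRing (𝓞 ↥(maximalRealSubfield L)) ↥(maximalRealSubfield L))]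
  [∀ v : HeightOneSpectrum (𝓞 ↥(maximalRealSubfield L)), MeasurableSpace (v.adicCompletion ↥(maximalRealSubfield L))] [∀ v : HeightOneSpectrum (𝓞 ↥(maximalRealSubfield L)), BorelSpace (v.adicCompletion ↥(maximalRealSubfield L))]

/-- **EULER PRODUCT AT `η_f`** (binder `hint`): `HasProd (v ↦ ν_v(𝒪_v)⁻¹·∫ P_v(t)^{−z}·ψ_v(η_v t) dν_v) (μ_f(𝒪̂)⁻¹·∫ h_f^{−z}·ψ_f(η_f ·) dμ_f)`, exceptional finset `S_δ ∪ S(η_f)` (★ FILE 3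
`hasProd_localCoeff_of_integrable'` at `g_v = P_v^{−z}`, ★ FILE 2 `continuous_localSymbol_cpow`, `coe_finFactor_cpow_eq_finprod`). [cite: TateThesis1967, Thm 3.3.1] [cite: Bump1997, §3.7] -/
theorem hasProd_localWhittaker_adele_cm_two (μf : Measure (FiniteAdeleRing (𝓞 ↥(maximalRealSubfield L)) ↥(maximalRealSubfield L))) [μf.IsAddHaarMeasure]
    (ν : ∀ v : HeightOneSpectrum (𝓞 ↥(maximalRealSubfield L)), Measure (v.adicCompletion ↥(maximalRealSubfield L))) [∀ v, (ν v).IsAddHaarMeasure] (z : ℂ)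
    (η : AdeleRing (𝓞 ↥(maximalRealSubfield L)) ↥(maximalRealSubfield L))
    (hint : Integrable (fun b : FiniteAdeleRing (𝓞 ↥(maximalRealSubfield L)) ↥(maximalRealSubfield L) => (((∏ᶠ v : HeightOneSpectrum (𝓞 L), max 1 ‖((traceZeroLine ↥(maximalRealSubfield L) L (IsCMField.complexConj L) hcδ hδ ((0, b) : AdeleRing (𝓞 ↥(maximalRealSubfield L)) ↥(maximalRealSubfield L)) : traceZeroAdele ↥(maximalRealSubfield L) L (IsCMField.complexConj L)) : AdeleRing (𝓞 L) L).2 v‖₊ : ℝ≥0) : ℝ) : ℂ) ^ (-z)) μf) :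
    HasProd (fun v : HeightOneSpectrum (𝓞 ↥(maximalRealSubfield L)) => (ν v (v.adicCompletionIntegers ↥(maximalRealSubfield L))).toReal⁻¹ •
        ∫ t, ((((letI := Extension.fintype (𝓞 ↥(maximalRealSubfield L)) ↥(maximalRealSubfield L) L (𝓞 L) v;
        ∏ w' : v.Extension (𝓞 L), max 1 (normAbs (w'.1.adicCompletion L) (Extension.adicCompletionSemialgHom ↥(maximalRealSubfield L) L w' t) * normAbs (w'.1.adicCompletion L) ((algebraMap L (FiniteAdeleRing (𝓞 L) L) δ) w'.1))) : ℝ≥0) : ℝ) : ℂ) ^ (-z) * (adeleAddCharAt ↥(maximalRealSubfield L) v (η.2 v * t) : ℂ) ∂ν v)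
      ((μf {b : FiniteAdeleRing (𝓞 ↥(maximalRealSubfield L)) ↥(maximalRealSubfield L) | ∀ v, b v ∈ v.adicCompletionIntegers ↥(maximalRealSubfield L)}).toReal⁻¹ •
          ∫ b, (((∏ᶠ v : HeightOneSpectrum (𝓞 L), max 1 ‖((traceZeroLine ↥(maximalRealSubfield L) L (IsCMField.complexConj L) hcδ hδ ((0, b) : AdeleRing (𝓞 ↥(maximalRealSubfield L)) ↥(maximalRealSubfield L)) : traceZeroAdele ↥(maximalRealSubfield L) L (IsCMField.complexConj L)) : AdeleRing (𝓞 L) L).2 v‖₊ : ℝ≥0) : ℝ) : ℂ) ^ (-z) * (finiteAdeleAddChar ↥(maximalRealSubfield L) (η.2 * b) : ℂ) ∂μf) := by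
  classical
  haveI : Algebra.IsQuadraticExtension ↥(maximalRealSubfield L) L := IsCMField.isQuadraticExtension L
  have hg1 : ∀ v ∉ (K2E1IntertwiningLocalFactorU2Line.finite_setOf_exists_extension_normAbs_ne_one (F := ↥(maximalRealSubfield L)) (E := L) hδ).toFinset,
      ∀ t ∈ v.adicCompletionIntegers ↥(maximalRealSubfield L), ((((letI := Extension.fintype (𝓞 ↥(maximalRealSubfield L)) ↥(maximalRealSubfield L) L (𝓞 L) v;
        ∏ w' : v.Extension (𝓞 L), max 1 (normAbs (w'.1.adicCompletion L) (Extension.adicCompletionSemialgHom ↥(maximalRealSubfield L) L w' t) * normAbs (w'.1.adicCompletion L) ((algebraMap L (FiniteAdeleRing (𝓞 L) L) δ) w'.1))) : ℝ≥0) : ℝ) : ℂ) ^ (-z) = 1 := by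
    intro v hv t ht
    rw [K2E1IntertwiningLocalFactorU2Line.prod_extension_max_one_eq_one_of_mem_integers (E := L) v (fun w' => not_not.1 fun h => hv ((Set.Finite.mem_toFinset _).2 ⟨w', h⟩)) ht,
      NNReal.coe_one, Complex.ofReal_one, Complex.one_cpow]
  have hfin : ∀ b : FiniteAdeleRing (𝓞 ↥(maximalRealSubfield L)) ↥(maximalRealSubfield L),
      (∏ᶠ v : HeightOneSpectrum (𝓞 ↥(maximalRealSubfield L)), ((((letI := Extension.fintype (𝓞 ↥(maximalRealSubfield L)) ↥(maximalRealSubfield L) L (𝓞 L) v;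
        ∏ w' : v.Extension (𝓞 L), max 1 (normAbs (w'.1.adicCompletion L) (Extension.adicCompletionSemialgHom ↥(maximalRealSubfield L) L w' (b v)) * normAbs (w'.1.adicCompletion L) ((algebraMap L (FiniteAdeleRing (𝓞 L) L) δ) w'.1))) : ℝ≥0) : ℝ) : ℂ) ^ (-z)) = (((∏ᶠ v : HeightOneSpectrum (𝓞 L), max 1 ‖((traceZeroLine ↥(maximalRealSubfield L) L (IsCMField.complexConj L) hcδ hδ ((0, b) : AdeleRing (𝓞 ↥(maximalRealSubfield L)) ↥(maximalRealSubfield L)) : traceZeroAdele ↥(maximalRealSubfield L) L (IsCMField.complexConj L)) : AdeleRing (𝓞 L) L).2 v‖₊ : ℝ≥0) : ℝ) : ℂ) ^ (-z) := fun b =>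
    (coe_finFactor_cpow_eq_finprod L hcδ hδ (-z) b).symm
  have h := hasProd_localCoeff_of_integrable' ↥(maximalRealSubfield L) μf ν (fun v t => ((((letI := Extension.fintype (𝓞 ↥(maximalRealSubfield L)) ↥(maximalRealSubfield L) L (𝓞 L) v;
        ∏ w' : v.Extension (𝓞 L), max 1 (normAbs (w'.1.adicCompletion L) (Extension.adicCompletionSemialgHom ↥(maximalRealSubfield L) L w' t) * normAbs (w'.1.adicCompletion L) ((algebraMap L (FiniteAdeleRing (𝓞 L) L) δ) w'.1))) : ℝ≥0) : ℝ) : ℂ) ^ (-z)) _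
    (fun v => continuous_localSymbol_cpow L z v) hg1 η.2 (by simp_rw [hfin]; exact hint)
  simp_rw [hfin] at h
  exact h

include hij hN in
/-- **EULER PRODUCT AT `η_f`, UNCONDITIONAL FOR `Re z > 1`** (§1 `integrable_finFactor_cpow_neg_cm_two` discharges `hint`). [cite: TateThesis1967, Thm 3.3.1] [cite: MoeglinWaldspurger1995, II.1.6] -/
theorem hasProd_localWhittaker_adele_cm_two_of_one_lt_re (μf : Measure (FiniteAdeleRing (𝓞 ↥(maximalRealSubfield L)) ↥(maximalRealSubfield L))) [μf.IsAddHaarMeasure]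
    (ν : ∀ v : HeightOneSpectrum (𝓞 ↥(maximalRealSubfield L)), Measure (v.adicCompletion ↥(maximalRealSubfield L))) [∀ v, (ν v).IsAddHaarMeasure] {z : ℂ} (hz : 1 < z.re)
    (η : AdeleRing (𝓞 ↥(maximalRealSubfield L)) ↥(maximalRealSubfield L)) :
    HasProd (fun v : HeightOneSpectrum (𝓞 ↥(maximalRealSubfield L)) => (ν v (v.adicCompletionIntegers ↥(maximalRealSubfield L))).toReal⁻¹ •
        ∫ t, ((((letI := Extension.fintype (𝓞 ↥(maximalRealSubfield L)) ↥(maximalRealSubfield L) L (𝓞 L) v;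
        ∏ w' : v.Extension (𝓞 L), max 1 (normAbs (w'.1.adicCompletion L) (Extension.adicCompletionSemialgHom ↥(maximalRealSubfield L) L w' t) * normAbs (w'.1.adicCompletion L) ((algebraMap L (FiniteAdeleRing (𝓞 L) L) δ) w'.1))) : ℝ≥0) : ℝ) : ℂ) ^ (-z) * (adeleAddCharAt ↥(maximalRealSubfield L) v (η.2 v * t) : ℂ) ∂ν v)
      ((μf {b : FiniteAdeleRing (𝓞 ↥(maximalRealSubfield L)) ↥(maximalRealSubfield L) | ∀ v, b v ∈ v.adicCompletionIntegers ↥(maximalRealSubfield L)}).toReal⁻¹ •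
          ∫ b, (((∏ᶠ v : HeightOneSpectrum (𝓞 L), max 1 ‖((traceZeroLine ↥(maximalRealSubfield L) L (IsCMField.complexConj L) hcδ hδ ((0, b) : AdeleRing (𝓞 ↥(maximalRealSubfield L)) ↥(maximalRealSubfield L)) : traceZeroAdele ↥(maximalRealSubfield L) L (IsCMField.complexConj L)) : AdeleRing (𝓞 L) L).2 v‖₊ : ℝ≥0) : ℝ) : ℂ) ^ (-z) * (finiteAdeleAddChar ↥(maximalRealSubfield L) (η.2 * b) : ℂ) ∂μf) :=
  hasProd_localWhittaker_adele_cm_two L hcδ hδ μf ν z η (integrable_finFactor_cpow_neg_cm_two L hij hN hcδ hδ μf hz)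

/-! ## §4 Regrouped off a finite set, unconditional for `Re z > 1`; and in ★ W2-arch's Mellin currency -/

include hij hN in
/-- **THE WHITTAKER COEFFICIENT AT AN ADELIC FREQUENCY, REGROUPED, `Re z > 1`** (NO integrability binder; NAMED unramified values `hW : ∀ v ∉ S, W_v(η_v,z) = 1 − q_v^{−2z}` = W2-fin (d)):
`μ(D)⁻¹·∫ Φ₁(t)ψ(ηt) dμ = (√|d_{L⁺}|)⁻¹·(φ₀·∏_w ∫_ℝ (1+(wδ)²x²)^{−z}e^{−2πiη_w x} dx)·((∏_{v∈S} W_v(η_v,z))·ζ^S_{L⁺}(2z)⁻¹)` (§2, §3, ★ FILE 1 `hasProd_mul_inv_partialZeta_of_eq_off`, `HasProd.unique`).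
[cite: Garrett2018, §1.10] [cite: Bump1997, §3.7] [cite: MoeglinWaldspurger1995, II.1.7] -/
theorem inv_measure_mul_integral_line_mul_adeleAddChar_eq_prod_cm_two_of_one_lt_re [MeasurableSpace (AdeleRing (𝓞 ↥(maximalRealSubfield L)) ↥(maximalRealSubfield L))] [BorelSpace (AdeleRing (𝓞 ↥(maximalRealSubfield L)) ↥(maximalRealSubfield L))]
    (μf : Measure (FiniteAdeleRing (𝓞 ↥(maximalRealSubfield L)) ↥(maximalRealSubfield L))) [μf.IsAddHaarMeasure]
    (ν : ∀ v : HeightOneSpectrum (𝓞 ↥(maximalRealSubfield L)), Measure (v.adicCompletion ↥(maximalRealSubfield L))) [∀ v, (ν v).IsAddHaarMeasure]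
    {σ : mixedSpace ↥(maximalRealSubfield L) × FiniteAdeleRing (𝓞 ↥(maximalRealSubfield L)) ↥(maximalRealSubfield L) → AdeleRing (𝓞 ↥(maximalRealSubfield L)) ↥(maximalRealSubfield L)}
    (hσ : ∀ p, (σ p).1 = (InfiniteAdeleRing.ringEquiv_mixedSpace ↥(maximalRealSubfield L)).symm p.1 ∧ (σ p).2 = p.2) (φ₀ : ℂ) {z : ℂ} (hz : 1 < z.re) (η : AdeleRing (𝓞 ↥(maximalRealSubfield L)) ↥(maximalRealSubfield L))
    (S : Finset (HeightOneSpectrum (𝓞 ↥(maximalRealSubfield L))))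
    (hW : ∀ v ∉ S, (ν v (v.adicCompletionIntegers ↥(maximalRealSubfield L))).toReal⁻¹ •
        ∫ t, ((((letI := Extension.fintype (𝓞 ↥(maximalRealSubfield L)) ↥(maximalRealSubfield L) L (𝓞 L) v;
        ∏ w' : v.Extension (𝓞 L), max 1 (normAbs (w'.1.adicCompletion L) (Extension.adicCompletionSemialgHom ↥(maximalRealSubfield L) L w' t) * normAbs (w'.1.adicCompletion L) ((algebraMap L (FiniteAdeleRing (𝓞 L) L) δ) w'.1))) : ℝ≥0) : ℝ) : ℂ) ^ (-z) * (adeleAddCharAt ↥(maximalRealSubfield L) v (η.2 v * t) : ℂ) ∂ν v =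
      1 - (v.residueCard : ℂ) ^ (-(2 * z))) :
    ((((((volume : Measure (mixedSpace ↥(maximalRealSubfield L))).prod μf).map σ) (adeleFundamentalDomain ↥(maximalRealSubfield L))).toReal⁻¹ : ℝ) : ℂ) *
        ∫ t, (φ₀ * ((∏ w : InfinitePlace L, ((1 : ℝ) + (w δ) ^ 2 * ((InfiniteAdeleRing.ringEquiv_mixedSpace ↥(maximalRealSubfield L) t.1).1 ⟨w.comap (algebraMap ↥(maximalRealSubfield L) L), K2E1HeightBigCellLineFormulaU2.isReal_comap_maximalRealSubfield L w⟩) ^ 2) : ℝ) : ℂ) ^ (-z)) * (((∏ᶠ v : HeightOneSpectrum (𝓞 L), max 1 ‖((traceZeroLine ↥(maximalRealSubfield L) L (IsCMField.complexConj L) hcδ hδ ((0, t.2) : AdeleRing (𝓞 ↥(maximalRealSubfield L)) ↥(maximalRealSubfield L)) : traceZeroAdele ↥(maximalRealSubfield L) L (IsCMField.complexConj L)) : AdeleRing (𝓞 L) L).2 v‖₊ : ℝ≥0) : ℝ) : ℂ) ^ (-z) * (adeleAddChar ↥(maximalRealSubfield L) (η * t) : ℂ) ∂(((volume : Measure (mixedSpace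 ↥(maximalRealSubfield L))).prod μf).map σ) =
      (((NNReal.sqrt ‖discr ↥(maximalRealSubfield L)‖₊ : ℝ≥0) : ℝ)⁻¹ : ℂ) * (φ₀ * ∏ w : InfinitePlace L, ∫ x : ℝ, (((1 + (w δ) ^ 2 * x ^ 2 : ℝ)) : ℂ) ^ (-z) *
          Complex.exp (-(2 * π * Complex.I * (InfiniteAdeleRing.ringEquiv_mixedSpace ↥(maximalRealSubfield L) η.1).1 ⟨w.comap (algebraMap ↥(maximalRealSubfield L) L), K2E1HeightBigCellLineFormulaU2.isReal_comap_maximalRealSubfield L w⟩ * x))) *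
        ((∏ v ∈ S, (ν v (v.adicCompletionIntegers ↥(maximalRealSubfield L))).toReal⁻¹ •
        ∫ t, ((((letI := Extension.fintype (𝓞 ↥(maximalRealSubfield L)) ↥(maximalRealSubfield L) L (𝓞 L) v;
        ∏ w' : v.Extension (𝓞 L), max 1 (normAbs (w'.1.adicCompletion L) (Extension.adicCompletionSemialgHom ↥(maximalRealSubfield L) L w' t) * normAbs (w'.1.adicCompletion L) ((algebraMap L (FiniteAdeleRing (𝓞 L) L) δ) w'.1))) : ℝ≥0) : ℝ) : ℂ) ^ (-z) * (adeleAddCharAt ↥(maximalRealSubfield L) v (η.2 v * t) : ℂ) ∂ν v) *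
          (partialStandardL (S : Set (HeightOneSpectrum (𝓞 ↥(maximalRealSubfield L)))) (fun _ => ({1} : Multiset ℂ)) (2 * z))⁻¹) := by
  haveI : SecondCountableTopology (FiniteAdeleRing (𝓞 ↥(maximalRealSubfield L)) ↥(maximalRealSubfield L)) := secondCountableTopology_finiteAdeleRing _
  haveI : LocallyCompactSpace (FiniteAdeleRing (𝓞 ↥(maximalRealSubfield L)) ↥(maximalRealSubfield L)) := locallyCompactSpace_finiteAdeleRing' _
  have hz' : 1 / 2 < z.re := by linarith
  rw [inv_measure_mul_integral_line_mul_adeleAddChar_eq_cm_two L hcδ hδ μf hσ φ₀ z η,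
    (hasProd_localWhittaker_adele_cm_two_of_one_lt_re L hij hN hcδ hδ μf ν hz η).unique (hasProd_mul_inv_partialZeta_of_eq_off S hz' hW).1]

include hij hN in
/-- **THE SAME IN ★ W2-ARCH'S MELLIN CURRENCY** (dealer (i)): every archimedean factor rewritten by ★ `integral_onePlusSqPow_mul_phase_eq_mellin` (`c_w = (wδ)² > 0` ★ `sq_apply_pos_of_ne_zero`,
`Re z > ½`): `𝓦_w(η_w, z) = Γ(z)⁻¹·√(π∕c_w)·𝓜[t ↦ e^{−t−A_w∕t}](z − ½)`, `A_w = π²η_w²∕c_w` — ENTIRE in `z` for `η_w ≠ 0` (★ `differentiable_mellin_expKernel`) with the strip bound ★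
`norm_mellin_expKernel_le` (`·e^{−√A_w} = e^{−π|η_w|∕√c_w}`), which is what W4 ★ sums and W5-A ★ continues. [cite: Bump1997, §1.6 (1.27)] [cite: Garrett2018, §1.10] -/
theorem inv_measure_mul_integral_line_mul_adeleAddChar_eq_prod_cm_two_mellin [MeasurableSpace (AdeleRing (𝓞 ↥(maximalRealSubfield L)) ↥(maximalRealSubfield L))] [BorelSpace (AdeleRing (𝓞 ↥(maximalRealSubfield L)) ↥(maximalRealSubfield L))]
    (μf : Measure (FiniteAdeleRing (𝓞 ↥(maximalRealSubfield L)) ↥(maximalRealSubfield L))) [μf.IsAddHaarMeasure]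
    (ν : ∀ v : HeightOneSpectrum (𝓞 ↥(maximalRealSubfield L)), Measure (v.adicCompletion ↥(maximalRealSubfield L))) [∀ v, (ν v).IsAddHaarMeasure]
    {σ : mixedSpace ↥(maximalRealSubfield L) × FiniteAdeleRing (𝓞 ↥(maximalRealSubfield L)) ↥(maximalRealSubfield L) → AdeleRing (𝓞 ↥(maximalRealSubfield L)) ↥(maximalRealSubfield L)}
    (hσ : ∀ p, (σ p).1 = (InfiniteAdeleRing.ringEquiv_mixedSpace ↥(maximalRealSubfield L)).symm p.1 ∧ (σ p).2 = p.2) (φ₀ : ℂ) {z : ℂ} (hz : 1 < z.re) (η : AdeleRing (𝓞 ↥(maximalRealSubfield L)) ↥(maximalRealSubfield L))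
    (S : Finset (HeightOneSpectrum (𝓞 ↥(maximalRealSubfield L))))
    (hW : ∀ v ∉ S, (ν v (v.adicCompletionIntegers ↥(maximalRealSubfield L))).toReal⁻¹ •
        ∫ t, ((((letI := Extension.fintype (𝓞 ↥(maximalRealSubfield L)) ↥(maximalRealSubfield L) L (𝓞 L) v;
        ∏ w' : v.Extension (𝓞 L), max 1 (normAbs (w'.1.adicCompletion L) (Extension.adicCompletionSemialgHom ↥(maximalRealSubfield L) L w' t) * normAbs (w'.1.adicCompletion L) ((algebraMap L (FiniteAdeleRing (𝓞 L) L) δ) w'.1))) : ℝ≥0) : ℝ) : ℂ) ^ (-z) * (adeleAddCharAt ↥(maximalRealSubfield L) v (η.2 v * t) : ℂ) ∂ν v =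
      1 - (v.residueCard : ℂ) ^ (-(2 * z))) :
    ((((((volume : Measure (mixedSpace ↥(maximalRealSubfield L))).prod μf).map σ) (adeleFundamentalDomain ↥(maximalRealSubfield L))).toReal⁻¹ : ℝ) : ℂ) *
        ∫ t, (φ₀ * ((∏ w : InfinitePlace L, ((1 : ℝ) + (w δ) ^ 2 * ((InfiniteAdeleRing.ringEquiv_mixedSpace ↥(maximalRealSubfield L) t.1).1 ⟨w.comap (algebraMap ↥(maximalRealSubfield L) L), K2E1HeightBigCellLineFormulaU2.isReal_comap_maximalRealSubfield L w⟩) ^ 2) : ℝ) : ℂ) ^ (-z)) * (((∏ᶠ v : HeightOneSpectrum (𝓞 L), max 1 ‖((traceZeroLine ↥(maximalRealSubfield L) L (IsCMField.complexConj L) hcδ hδ ((0, t.2) : AdeleRing (𝓞 ↥(maximalRealSubfield L)) ↥(maximalRealSubfield L)) : traceZeroAdele ↥(maximalRealSubfield L) L (IsCMField.complexConj L)) : AdeleRing (𝓞 L) L).2 v‖₊ : ℝ≥0) : ℝ) : ℂ) ^ (-z) * (adeleAddChar ↥(maximalRealSubfield L) (η * t) : ℂ) ∂(((volume : Measure (mixedSpace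 ↥(maximalRealSubfield L))).prod μf).map σ) =
      (((NNReal.sqrt ‖discr ↥(maximalRealSubfield L)‖₊ : ℝ≥0) : ℝ)⁻¹ : ℂ) * (φ₀ * ∏ w : InfinitePlace L, ((Complex.Gamma z)⁻¹ * ((Real.sqrt (π / (w δ) ^ 2) : ℝ) : ℂ) *
          mellin (fun t : ℝ => Complex.exp (-(t : ℂ) - ((π ^ 2 * ((InfiniteAdeleRing.ringEquiv_mixedSpace ↥(maximalRealSubfield L) η.1).1 ⟨w.comap (algebraMap ↥(maximalRealSubfield L) L), K2E1HeightBigCellLineFormulaU2.isReal_comap_maximalRealSubfield L w⟩) ^ 2 / (w δ) ^ 2 : ℝ) : ℂ) / (t : ℂ))) (z - 1 / 2))) *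
        ((∏ v ∈ S, (ν v (v.adicCompletionIntegers ↥(maximalRealSubfield L))).toReal⁻¹ •
        ∫ t, ((((letI := Extension.fintype (𝓞 ↥(maximalRealSubfield L)) ↥(maximalRealSubfield L) L (𝓞 L) v;
        ∏ w' : v.Extension (𝓞 L), max 1 (normAbs (w'.1.adicCompletion L) (Extension.adicCompletionSemialgHom ↥(maximalRealSubfield L) L w' t) * normAbs (w'.1.adicCompletion L) ((algebraMap L (FiniteAdeleRing (𝓞 L) L) δ) w'.1))) : ℝ≥0) : ℝ) : ℂ) ^ (-z) * (adeleAddCharAt ↥(maximalRealSubfield L) v (η.2 v * t) : ℂ) ∂ν v) *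
          (partialStandardL (S : Set (HeightOneSpectrum (𝓞 ↥(maximalRealSubfield L)))) (fun _ => ({1} : Multiset ℂ)) (2 * z))⁻¹) := by
  have hz' : 1 / 2 < z.re := by linarith
  rw [inv_measure_mul_integral_line_mul_adeleAddChar_eq_prod_cm_two_of_one_lt_re L hij hN hcδ hδ μf ν hσ φ₀ hz η S hW]
  congr 3
  exact Finset.prod_congr rfl fun w _ => integral_onePlusSqPow_mul_phase_eq_mellin hz' (sq_apply_pos_of_ne_zero L hδ w) _

end Euler

end Summit.HodgeConjecture.HodgeConjecture.Cruxes.H413.K2E1WhittakerCoefficientEulerProductAdelicU2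

end
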